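import Literature.Algebra.Lie.SemisimpleSmallDimension
import HarnessLib

/-!
# Goursat's lemma for Lie algebras with a simple factor: a subalgebra of `𝔞 × 𝔟` projecting ONTO a simple `𝔞` and onto `𝔟`
# is all of `𝔞 × 𝔟`, or is the graph of a surjection `𝔟 ↠ 𝔞`

Topic `Literature/Algebra/Lie`.  Theorems only (no definition, no named fact), Mathlib vocabulary (`LieHom`, `LieIdeal`,
`LieAlgebra.IsSimple`, `LieAlgebra.IsSemisimple`).  Written for the cell `pub-hodgecm2` (COR-CM), seat `b27` gen 47
(count-neutral Mumford–Tate-rank ladder: Hodge groups of PRODUCTS `X₁ × X₂`, Moonen–Zarhin 1999 §3 (3.1) «`Hg(X₁ × X₂)` is an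
algebraic subgroup of `Hg(X₁) × Hg(X₂)`; the two projections are surjective», read for the Lie algebras).

SETTING.  Instead of a subalgebra of a product we take the invariant form: a Lie algebra `𝔤` with two Lie homomorphisms
`f : 𝔤 → 𝔞`, `g : 𝔤 → 𝔟` which are JOINTLY INJECTIVE (`ker f ⊓ ker g = ⊥`; i.e. `(f, g) : 𝔤 ↪ 𝔞 × 𝔟`), both SURJECTIVE,
with `𝔞` SIMPLE; everything finite-dimensional over a field `K`.

* **`finrank_eq_add_or_exists_ideal`** (Goursat / Ribet's lemma) — EITHER `dim 𝔤 = dim 𝔞 + dim 𝔟` (then `(f, g)` is a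
  linear isomorphism `𝔤 ≅ 𝔞 × 𝔟`: `ker g` maps ONTO `𝔞`), OR `g` is injective (so `𝔤 ≅ 𝔟`) and `𝔟` has an ideal `I` with
  `dim I + dim 𝔞 = dim 𝔟` (the kernel of the induced surjection `f ∘ g⁻¹ : 𝔟 ↠ 𝔞`).  Proof: `f(ker g)` is an ideal of
  `𝔞 = f(𝔤)`, hence `⊥` or `⊤`; `⊥` gives `ker g ⊆ ker f ⊓ ker g = 0`; `⊤` gives `(f, g)` onto.
* **`finrank_eq_add_of_isSimple_of_finrank_ne`** — if moreover `𝔟` is simple and `dim 𝔞 ≠ dim 𝔟`, then `dim 𝔤 = dim 𝔞 + dim 𝔟`.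
* `hasTrivialRadical_lieIdeal` — an ideal of a semisimple Lie algebra has trivial radical (it is complemented by an ideal
  commuting with it, so its abelian ideals are abelian ideals of the whole algebra); hence (`finrank_lieIdeal_ne`) its
  dimension is `∉ {1, 2, 4, 5, 7}` in characteristic `0` (`SemisimpleSmallDimension.finrank_ne_of_hasTrivialRadical`).
* **`finrank_eq_add_of_isSemisimple_of_sub_mem`** — if `𝔟` is semisimple (characteristic `0`) and `dim 𝔟 − dim 𝔞 ∈ {1, 2, 4, 5, 7}`,
  then `dim 𝔤 = dim 𝔞 + dim 𝔟` (no ideal of `𝔟` has the codimension `dim 𝔞`).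

USE (`Motives/HodgeLieProductSimpleFactor`, `CorCM/MumfordTateRankCurveTimesSurface`): `𝔤 = Lie Hg(H¹(X₁ × X₂))`,
`𝔞 = Lie Hg(H¹X₁) ≅ 𝔰𝔩₂` (a non-CM elliptic curve), `𝔟 = Lie Hg(H¹X₂)` (`Res_{K/ℚ} 𝔰𝔩₂` for a real-multiplication surface,
`𝔰𝔭₄` for a surface with `End⁰ = ℚ`): `dim 𝔟 − dim 𝔞 ∈ {3, 7}`, and `Hg(E × S) = Hg(E) × Hg(S)` at the level of Lie algebras.

## References
* [Hazama1983] F. Hazama, *Algebraic cycles on abelian varieties with many real endomorphisms*, Tôhoku Math. J. 35 (1983)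
  303–308, §3 Lemma (3.1) (Goursat's lemma for Lie algebras) and Prop. (2.6) (Ribet's lemma). [cite: Hazama1983, Lemma (3.1)]
* [MoonenZarhin1999LowDim] B. Moonen, Yu. G. Zarhin, *Hodge classes on abelian varieties of low dimension*, Math. Ann. 315
  (1999), §3 (3.1) and Lemma (3.6). [cite: MoonenZarhin1999LowDim, §3 (3.1)]
* [Humphreys1972] J. E. Humphreys, *Introduction to Lie Algebras and Representation Theory*, GTM 9 (1972), §5.2 (ideals of a
  semisimple Lie algebra), §8.4. [cite: Humphreys1972, §5.2]
-/

namespace Literature.Algebra.Lie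

namespace GoursatSimpleFactor

open LieAlgebra Module

variable {K : Type*} [Field K] {𝔤 𝔞 𝔟 : Type*} [LieRing 𝔤] [LieAlgebra K 𝔤] [LieRing 𝔞] [LieAlgebra K 𝔞]
  [LieRing 𝔟] [LieAlgebra K 𝔟]

/-! ### §1 Ideals of a semisimple Lie algebra have trivial radical -/

/-- **An ideal of a semisimple Lie algebra has trivial radical.**  In the Boolean algebra of ideals of a semisimple `L` the ideal
`I` has a complement `Iᶜ` with `⁅Iᶜ, I⁆ ⊆ I ⊓ Iᶜ = 0` and `I + Iᶜ = L`; so an ideal `J` of the Lie algebra `I` is an ideal of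
`L` (`⁅a + b, y⁆ = ⁅a, y⁆` for `a ∈ I`, `b ∈ Iᶜ`, `y ∈ J`), and if `J` is abelian it vanishes because `L` has no non-zero abelian
ideals. [cite: Humphreys1972, §5.2] -/
theorem hasTrivialRadical_lieIdeal {L : Type*} [LieRing L] [LieAlgebra K L] [IsSemisimple K L] (I : LieIdeal K L) :
    HasTrivialRadical K I := by
  rw [hasTrivialRadical_iff_no_abelian_ideals]
  intro J hJ
  -- `J`, transported to `L`, is an ideal of `L`
  let J' : LieIdeal K L :=
    { __ := J.toSubmodule.map I.incl.toLinearMap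
      lie_mem := by
        rintro x _ ⟨y, hy, rfl⟩
        have hx : x ∈ I ⊔ Iᶜ := by
          rw [(isCompl_compl (x := I)).sup_eq_top]
          exact LieSubmodule.mem_top x
        rw [LieSubmodule.mem_sup] at hx
        obtain ⟨a, ha, b, hb, rfl⟩ := hx
        simp only [Submodule.carrier_eq_coe, add_lie, SetLike.mem_coe]
        apply add_mem
        · simp only [Submodule.mem_map, LieSubmodule.mem_toSubmodule, Subtype.exists]
          erw [Submodule.coe_subtype]
          simp only [exists_and_right, exists_eq_right, ha, lie_mem_left, exists_true_left]
          exact lie_mem_right K I J ⟨a, ha⟩ y hy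
        · suffices h0 : ⁅b, y.val⁆ = 0 by erw [h0]; simp only [zero_mem]
          rw [← LieSubmodule.mem_bot (R := K) (L := L), ← (isCompl_compl (x := I)).inf_eq_bot]
          exact ⟨lie_mem_right K L I b y y.2, lie_mem_left K L Iᶜ b y hb⟩ }
  -- `J'` is abelian, hence zero
  have hJ'ab : IsLieAbelian J' := by
    constructor
    rintro ⟨_, ⟨x, hx, rfl⟩⟩ ⟨_, ⟨y, hy, rfl⟩⟩
    apply Subtype.ext
    change ⁅((x : I) : L), ((y : I) : L)⁆ = (0 : L)
    have h := hJ.trivial ⟨x, hx⟩ ⟨y, hy⟩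
    have h' := congrArg (fun z : J => ((z : I) : L)) h
    simpa using h'
  have hJ' : J' = ⊥ := (hasTrivialRadical_iff_no_abelian_ideals (R := K) (L := L)).1 inferInstance J' hJ'ab
  rw [eq_bot_iff]
  intro x hx
  have hx' : (x : L) ∈ J' := ⟨x, hx, rfl⟩
  rw [hJ', LieSubmodule.mem_bot] at hx'
  rw [LieSubmodule.mem_bot]
  exact Subtype.ext hx'

/-- **The dimension of an ideal of a semisimple Lie algebra over a field of characteristic `0` is `∉ {1, 2, 4, 5, 7}`** (it has
trivial radical, and `dim = rank + #roots`). [cite: Humphreys1972, §5.2] [cite: Humphreys1972, §8.4] -/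
theorem finrank_lieIdeal_ne [CharZero K] {L : Type*} [LieRing L] [LieAlgebra K L] [FiniteDimensional K L] [IsSemisimple K L]
    (I : LieIdeal K L) :
    finrank K I ≠ 1 ∧ finrank K I ≠ 2 ∧ finrank K I ≠ 4 ∧ finrank K I ≠ 5 ∧ finrank K I ≠ 7 := by
  haveI := hasTrivialRadical_lieIdeal (K := K) I
  haveI : Module.Finite K I := Module.Finite.of_injective I.toSubmodule.subtype Subtype.val_injective
  exact SemisimpleSmallDimension.finrank_ne_of_hasTrivialRadical (K := K) (L := I)

/-! ### §2 Goursat's lemma with a simple factor -/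

section Goursat

variable [FiniteDimensional K 𝔞] [FiniteDimensional K 𝔟] (f : 𝔤 →ₗ⁅K⁆ 𝔞) (g : 𝔤 →ₗ⁅K⁆ 𝔟)

/-- A simple Lie algebra has positive dimension. [cite: Humphreys1972, §5.2] -/
theorem finrank_pos_of_isSimple [IsSimple K 𝔞] : 0 < finrank K 𝔞 := by
  haveI : Nontrivial 𝔞 := by
    by_contra h
    rw [not_nontrivial_iff_subsingleton] at h
    exact IsSimple.non_abelian K (L := 𝔞) inferInstance
  exact finrank_pos

/-- **Goursat's lemma with a simple factor.**  Let `f : 𝔤 → 𝔞`, `g : 𝔤 → 𝔟` be surjective Lie homomorphisms with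
`ker f ⊓ ker g = 0` and `𝔞` simple.  Then either `dim 𝔤 = dim 𝔞 + dim 𝔟` (and every `a ∈ 𝔞` is `f x` for some `x` with
`g x = 0`: `(f, g) : 𝔤 ≅ 𝔞 × 𝔟`), or `g` is injective and `𝔟` has an ideal `I` with `dim I + dim 𝔞 = dim 𝔟` (the kernel of
`f ∘ g⁻¹ : 𝔟 ↠ 𝔞`).  The ideal `f(ker g)` of `𝔞` is `0` or `𝔞`. [cite: Hazama1983, Lemma (3.1)] [cite: MoonenZarhin1999LowDim, §3 (3.1)] -/
theorem finrank_eq_add_or_exists_ideal [IsSimple K 𝔞] (hf : Function.Surjective f) (hg : Function.Surjective g)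
    (hker : f.ker ⊓ g.ker = ⊥) :
    (finrank K 𝔤 = finrank K 𝔞 + finrank K 𝔟 ∧ ∀ a : 𝔞, ∃ x : 𝔤, f x = a ∧ g x = 0) ∨
      (Function.Injective g ∧ ∃ I : LieIdeal K 𝔟, finrank K I + finrank K 𝔞 = finrank K 𝔟) := by
  rcases IsSimple.eq_bot_or_eq_top ((g.ker).map f) with h0 | h1
  · -- `f (ker g) = 0`: `ker g ⊆ ker f ⊓ ker g = 0`
    right
    have hgk : g.ker = ⊥ := by
      rw [LieIdeal.map_eq_bot_iff] at h0
      rw [eq_bot_iff, ← hker]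
      exact le_inf h0 le_rfl
    have hginj : Function.Injective g := by
      rw [← LieHom.ker_eq_bot]; exact hgk
    refine ⟨hginj, ?_⟩
    let e : 𝔤 ≃ₗ⁅K⁆ 𝔟 := LieEquiv.ofBijective g ⟨hginj, hg⟩
    let φ : 𝔟 →ₗ⁅K⁆ 𝔞 := f.comp (e.symm : 𝔟 →ₗ⁅K⁆ 𝔤)
    have hφ : Function.Surjective φ := hf.comp e.symm.surjective
    refine ⟨φ.ker, ?_⟩
    have h := LinearMap.finrank_range_add_finrank_ker (φ : 𝔟 →ₗ[K] 𝔞)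
    rw [LinearMap.range_eq_top.2 hφ, finrank_top] at h
    have hk : finrank K φ.ker = finrank K (LinearMap.ker (φ : 𝔟 →ₗ[K] 𝔞)) := by
      rw [← LieHom.ker_toSubmodule]; rfl
    omega
  · -- `f (ker g) = 𝔞`: `(f, g)` is onto `𝔞 × 𝔟`
    left
    have hlift : ∀ a : 𝔞, ∃ x : 𝔤, f x = a ∧ g x = 0 := fun a => by
      obtain ⟨⟨x, hx⟩, hxa⟩ := LieIdeal.mem_map_of_surjective hf (h1 ▸ LieSubmodule.mem_top a : a ∈ (g.ker).map f)
      exact ⟨x, hxa, (LieHom.mem_ker.1 hx)⟩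
    refine ⟨?_, hlift⟩
    let F : 𝔤 →ₗ[K] 𝔞 × 𝔟 := LinearMap.prod (f : 𝔤 →ₗ[K] 𝔞) (g : 𝔤 →ₗ[K] 𝔟)
    have hFinj : Function.Injective F := by
      rw [← LinearMap.ker_eq_bot, LinearMap.ker_prod, eq_bot_iff]
      intro x hx
      have hx' : x ∈ f.ker ⊓ g.ker := by
        rw [LieSubmodule.mem_inf, LieHom.mem_ker, LieHom.mem_ker]
        exact ⟨(LinearMap.mem_ker.1 (Submodule.mem_inf.1 hx).1), (LinearMap.mem_ker.1 (Submodule.mem_inf.1 hx).2)⟩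
      rw [hker] at hx'
      exact (LieSubmodule.mem_bot x).1 hx'
    have hFsurj : Function.Surjective F := by
      rintro ⟨a, b⟩
      obtain ⟨y, hy⟩ := hg b
      obtain ⟨x, hxa, hxg⟩ := hlift (a - f y)
      refine ⟨x + y, ?_⟩
      ext
      · change f (x + y) = a
        rw [map_add, hxa, sub_add_cancel]
      · change g (x + y) = b
        rw [map_add, hxg, zero_add, hy]
    have e := LinearEquiv.ofBijective F ⟨hFinj, hFsurj⟩
    rw [e.finrank_eq, Module.finrank_prod]

/-- **Goursat with two simple factors of different dimensions**: `f : 𝔤 ↠ 𝔞`, `g : 𝔤 ↠ 𝔟` jointly injective, `𝔞` and `𝔟`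
simple, `dim 𝔞 ≠ dim 𝔟` ⟹ `dim 𝔤 = dim 𝔞 + dim 𝔟` (an ideal of the simple `𝔟` of codimension `dim 𝔞 ∉ {0, dim 𝔟}` does not exist).
[cite: Hazama1983, Lemma (3.1)] [cite: MoonenZarhin1999LowDim, §3 (3.1)] -/
theorem finrank_eq_add_of_isSimple_of_finrank_ne [IsSimple K 𝔞] [IsSimple K 𝔟] (hf : Function.Surjective f)
    (hg : Function.Surjective g) (hker : f.ker ⊓ g.ker = ⊥) (hne : finrank K 𝔞 ≠ finrank K 𝔟) :
    finrank K 𝔤 = finrank K 𝔞 + finrank K 𝔟 := by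
  rcases finrank_eq_add_or_exists_ideal f g hf hg hker with ⟨h, -⟩ | ⟨-, I, hI⟩
  · exact h
  · exfalso
    have ha := finrank_pos_of_isSimple (K := K) (𝔞 := 𝔞)
    rcases IsSimple.eq_bot_or_eq_top I with h | h
    · have e : finrank K (⊥ : LieIdeal K 𝔟) = finrank K (⊥ : LieIdeal K 𝔟).toSubmodule := rfl
      rw [LieSubmodule.bot_toSubmodule, finrank_bot] at e
      rw [h, e] at hI
      exact hne (by omega)
    · have e : finrank K (⊤ : LieIdeal K 𝔟) = finrank K (⊤ : LieIdeal K 𝔟).toSubmodule := rfl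
      rw [LieSubmodule.top_toSubmodule, finrank_top] at e
      rw [h, e] at hI
      omega

/-- **Goursat with a simple and a semisimple factor, by dimension**: `f : 𝔤 ↠ 𝔞`, `g : 𝔤 ↠ 𝔟` jointly injective, `𝔞` simple,
`𝔟` semisimple over a field of characteristic `0`, and `dim 𝔟 − dim 𝔞 ∈ {1, 2, 4, 5, 7}` ⟹ `dim 𝔤 = dim 𝔞 + dim 𝔟` (an ideal of
`𝔟` of that dimension would have trivial radical, `finrank_lieIdeal_ne`). [cite: Hazama1983, Lemma (3.1)] [cite: Humphreys1972, §8.4] -/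
theorem finrank_eq_add_of_isSemisimple_of_sub_mem [CharZero K] [IsSimple K 𝔞] [IsSemisimple K 𝔟]
    (hf : Function.Surjective f) (hg : Function.Surjective g) (hker : f.ker ⊓ g.ker = ⊥)
    (hd : finrank K 𝔟 = finrank K 𝔞 + 1 ∨ finrank K 𝔟 = finrank K 𝔞 + 2 ∨ finrank K 𝔟 = finrank K 𝔞 + 4 ∨
      finrank K 𝔟 = finrank K 𝔞 + 5 ∨ finrank K 𝔟 = finrank K 𝔞 + 7) :
    finrank K 𝔤 = finrank K 𝔞 + finrank K 𝔟 := by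
  rcases finrank_eq_add_or_exists_ideal f g hf hg hker with ⟨h, -⟩ | ⟨-, I, hI⟩
  · exact h
  · exfalso
    have hI' := finrank_lieIdeal_ne (K := K) I
    omega

end Goursat

end GoursatSimpleFactor

end Literature.Algebra.Lie
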